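import Summits.ABC.ABC.Theorems.IsogenyGlueCongruenceEllipticGluingPrimeBoundSimpleOfBound
import HarnessLib

/-!
# Crux U `EllipticGluingPrimeBound` (stmt-ABC-13919): the `d = 1` slice — U implies
# fixed-curve torsion sharing bounded UNIFORMLY in the partner curve

Line `Sketch` (isotypic–Minkowski reduction) proved the crux
`Summit.ABC.ABC.Theses.IsogenyGlueCongruence.EllipticGluingPrimeBound` (U) EQUIVALENT, modulo
three published inputs, to its residual `U_simple` (height-free torsion sharing with ℚ-simple
geometrically `E`-free partners; `ellipticGluingPrimeBound_iff_simple`, p118731), the direction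
`U → U_simple` being unconditional (`simpleFreeTorsionBound_of_ellipticGluingPrimeBound`,
p117529). This file records, as a theorem, the smallest slice of that residual — partners of
dimension ONE — which is the measure of the crux's difficulty used by the line's leads and by
the standing disprover (`Cruxes/EllipticGluingPrimeBound/Disproof.lean` §3 F6, §4):

* `fixedCurveTorsionSharing_of_ellipticGluingPrimeBound` — **U ⟹** there are absolute `κ ≥ 0`,
  `C` such that for every elliptic `W/ℚ`, every elliptic `W'/ℚ` whose abelian-variety model is
  geometrically free of the model of `W` (no non-zero `ℚ̄`-homomorphism `E_ℚ̄ → A_ℚ̄`, i.e. `W'`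
  not geometrically isogenous to `W`), and every prime `ℓ` at which `W[ℓ]` is irreducible and
  embeds `Γ_ℚ`-equivariantly into `W'(ℚ̄)` (equivalently `W[ℓ] ≅ W'[ℓ]`):
  `ℓ ≤ C · max(1, h_F(W))^κ` — a bound depending on `W` ALONE, uniform in the congruent partner
  `W'` (whose height and conductor are arbitrary).

Read for a FIXED curve `W` this says: only the primes `ℓ ≤ C · max(1, h_F(W))^κ` can carry a
mod-`ℓ` congruence between `W` and a non-isogenous curve — the fixed-curve Frey–Mazur finiteness
with a polynomial threshold (Frey 1997, Conj. 5 is the height-dependent pair form; the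
fixed-curve finiteness is open, known for `d = 1` only as a consequence of the `abc`/height
conjecture via Frey's Tate-curve argument; record `ℓ = 17` for non-isogenous congruent pairs over
`ℚ`, Cremona–Freitas 2021 / Fisher). So every proof of U proves this statement; it is landed
`--supports stmt-ABC-13919` as the line's formal hardness certificate, not as progress towards U.

Proof: specialise `U_simple` to `A :=` an abelian-variety model of `W'` (`dim A = 1` by
`dim_eq_one_of_equiv`, hence ℚ-simple by `AbelianVariety.isSimple_of_dim_le_one`), transport the
embedding along `e'⁻¹ : W'(ℚ̄) ≃ A(ℚ̄)`, and absorb `(1 + 1)^κ` into the constant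
(`C' = max C 0 · 2^κ`). Unconditional; no new definitions; no `sorry`.
-/

noncomputable section

-- `Summit.<Summit>.<Problem>` is the mandated summit-side namespace (CONVENTIONS §2); for the
-- single-conjunct summit `ABC` the two coincide, so the duplicate `ABC.ABC` is deliberate.
set_option linter.dupNamespace false

namespace Summit.ABC.ABC.Theorems.IsotypicMinkowski

open CategoryTheory CategoryTheory.Limits AlgebraicGeometry
open Literature.AlgebraicGeometry.Motives
open Summit.ABC.ABC.Theses.IsogenyGlueCongruence

/-- **U ⟹ fixed-curve torsion sharing, uniform in the partner curve (the `d = 1` slice of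
`U_simple`).** If `EllipticGluingPrimeBound` holds then there are absolute `κ ≥ 0`, `C` such that
for all elliptic `W, W'/ℚ` with abelian-variety models `(E, e)`, `(A, e')` (equivariant
identifications of `ℚ̄`-points), `Hom(E_ℚ̄, A_ℚ̄) = 0` (the partner is not geometrically isogenous
to `W`), and every prime `ℓ` with `W[ℓ]` irreducible admitting a `Γ_ℚ`-equivariant injection
`W[ℓ] ↪ W'(ℚ̄)`: `ℓ ≤ C · max(1, h_F(W))^κ`. The bound sees `W` only. -/
theorem fixedCurveTorsionSharing_of_ellipticGluingPrimeBound :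
    EllipticGluingPrimeBound → ∃ κ C : ℝ, 0 ≤ κ ∧ ∀ (W W' : WeierstrassCurve ℚ) [W.IsElliptic]
      [W'.IsElliptic] (E A : AbelianVariety.{0} ℚ) (e : E.geomPoints ≃+ W.geomPoints)
      (e' : A.geomPoints ≃+ W'.geomPoints),
      (∀ (σ : Field.absoluteGaloisGroup ℚ) (P : E.geomPoints), e (σ • P) = σ • e P) →
      (∀ (σ : Field.absoluteGaloisGroup ℚ) (P : A.geomPoints), e' (σ • P) = σ • e' P) →
      (∀ f : E.baseChange (AlgebraicClosure ℚ) ⟶ A.baseChange (AlgebraicClosure ℚ), f = 0) →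
      ∀ ℓ : ℕ, ℓ.Prime → W.HasIrreducibleModPGaloisRep ℓ →
      (∃ ι : W.geomTorsion ℓ →+ W'.geomPoints, Function.Injective ι ∧
        ∀ (σ : Field.absoluteGaloisGroup ℚ) (P : W.geomTorsion ℓ), ι (σ • P) = σ • ι P) →
        (ℓ : ℝ) ≤ C * (max 1 W.stableFaltingsHeight) ^ κ := by
  intro hU
  obtain ⟨κ, C, hκ, h⟩ := simpleFreeTorsionBound_of_ellipticGluingPrimeBound hU
  refine ⟨κ, max C 0 * (2 : ℝ) ^ κ, hκ, ?_⟩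
  intro W W' _ _ E A e e' he he' hfree ℓ hℓ hirr hι
  obtain ⟨ι, hinj, hιeq⟩ := hι
  -- transport the embedding along `e'⁻¹ : W'(ℚ̄) ≃ A(ℚ̄)`
  have he'symm : ∀ (σ : Field.absoluteGaloisGroup ℚ) (Q : W'.geomPoints),
      e'.symm (σ • Q) = σ • e'.symm Q := by
    intro σ Q
    apply e'.injective
    rw [he', e'.apply_symm_apply, e'.apply_symm_apply]
  let ι' : W.geomTorsion ℓ →+ A.geomPoints := (e'.symm : W'.geomPoints →+ A.geomPoints).comp ι
  have hι' : ∃ ι' : W.geomTorsion ℓ →+ A.geomPoints, Function.Injective ι' ∧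
      ∀ (σ : Field.absoluteGaloisGroup ℚ) (P : W.geomTorsion ℓ), ι' (σ • P) = σ • ι' P := by
    refine ⟨ι', e'.symm.injective.comp hinj, fun σ P ↦ ?_⟩
    show e'.symm (ι (σ • P)) = σ • e'.symm (ι P)
    rw [hιeq, he'symm]
  have hA1 : A.dim = 1 := dim_eq_one_of_equiv e'
  have hsimple : AbelianVariety.IsSimple A := AbelianVariety.isSimple_of_dim_le_one hA1.le
  have hbound := h W E A e he hfree hsimple ℓ hℓ hirr hι'
  -- absorb `(dim A + 1)^κ = 2^κ` into the constant
  set m : ℝ := max 1 W.stableFaltingsHeight with hm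
  have hm1 : (1 : ℝ) ≤ m := le_max_left _ _
  have hm0 : (0 : ℝ) ≤ m := zero_le_one.trans hm1
  have hdim : ((A.dim : ℝ) + 1) = 2 := by rw [hA1]; norm_num
  rw [hdim] at hbound
  have hsplit : ((2 : ℝ) * m) ^ κ = (2 : ℝ) ^ κ * m ^ κ := Real.mul_rpow (by norm_num) hm0
  have h2κ : (0 : ℝ) ≤ (2 : ℝ) ^ κ := Real.rpow_nonneg (by norm_num) κ
  have hmκ : (0 : ℝ) ≤ m ^ κ := Real.rpow_nonneg hm0 κ
  calc (ℓ : ℝ) ≤ C * ((2 : ℝ) * m) ^ κ := hbound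
    _ ≤ max C 0 * ((2 : ℝ) * m) ^ κ :=
        mul_le_mul_of_nonneg_right (le_max_left _ _) (Real.rpow_nonneg (by positivity) κ)
    _ = max C 0 * (2 : ℝ) ^ κ * m ^ κ := by rw [hsplit, mul_assoc]

end Summit.ABC.ABC.Theorems.IsotypicMinkowski

end
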